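import Literature.AlgebraicGeometry.Resolution.BlowupsExistence
import Literature.AlgebraicGeometry.Resolution.BlowupsIntegral
import Literature.AlgebraicGeometry.Resolution.BlowupsProperProofs
import Mathlib.AlgebraicGeometry.IdealSheaf.Functorial
import HarnessLib

/-!
# Blow-up principalization (crux `FrobeniusLadder.FRationalModification`, line `birth` v3,
stub `stub_blowupPrincipalization`)

CM-free principalization of a closed subscheme `Z ⊊ Y` of an integral locally Noetherian scheme:
the blowing up `π : Bl_Z Y → Y` is proper and birational, `Bl_Z Y` is integral, the scheme-theoretic
preimage `Z.comap π` is an effective Cartier divisor, and `π` is an isomorphism over `Y ∖ Supp Z` —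
all from the tree's blow-up API (`exists_isBlowup`, `IsBlowup.isProper`, `IsBlowup.isIntegral`,
`IsBlowup.isBirational'`, `IsBlowup.isEffectiveCartier`, `IsBlowup.isIso_compl`).
-/

-- single-problem summit: the doubled namespace component `ResolutionOfSingularities` is forced
set_option linter.dupNamespace false

noncomputable section

open CategoryTheory AlgebraicGeometry TopologicalSpace
open Literature.AlgebraicGeometry.Resolution

namespace Summit.ResolutionOfSingularities.ResolutionOfSingularities.Theorems.FRationalModification.BlowupPrincipalization

/-- **Blow-up principalization** (Stacks 02ND, 02NS, 02OS; Görtz–Wedhorn I, Prop. 13.91–13.96): for an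
integral locally Noetherian scheme `Y` and an ideal sheaf `Z` whose support is not all of `Y`, the blowing
up `π : W = Bl_Z Y → Y` is proper and birational, `W` is integral, `Z.comap π` is an effective Cartier
divisor, and `π` is an isomorphism over the complement of `Supp Z`. [folklore] -/
theorem stub_blowupPrincipalization (Y : Scheme.{0}) [IsIntegral Y] [IsLocallyNoetherian Y]
    (Z : Y.IdealSheafData) (hZ : Z.support ≠ ⊤) :
    ∃ (W : Scheme.{0}) (π : W ⟶ Y), IsProper π ∧ IsBirational π ∧ IsIntegral W ∧
      IsEffectiveCartier (Z.comap π) ∧ IsIso (π ∣_ Z.support.compl) := by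
  have hZ' : Z ≠ ⊥ := fun h => hZ (Scheme.IdealSheafData.support_eq_top_iff.mpr h)
  obtain ⟨W, π, hπ⟩ := exists_isBlowup Y Z
  exact ⟨W, π, hπ.isProper, hπ.isBirational' hZ', hπ.isIntegral hZ', hπ.isEffectiveCartier,
    hπ.isIso_compl⟩

end Summit.ResolutionOfSingularities.ResolutionOfSingularities.Theorems.FRationalModification.BlowupPrincipalization

end
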